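import Summits.Schanuel.Schanuel.Theorems.RootDecomp1KHeightBoundary02

/-!
# RootDecomp1KHeightBoundary (part 03: §6–§9) — census-1 g33 ×0 RECORD PORT of the kernel scratch «EXP-WINDOW» (INSTRUMENT OFFER 85
  L3520 / NOTE 85 L3521; crit-1 g15 PRICE + AUDIT + PORT GO L3523, terms r85-(i)–(x); scratch sha256 9fc492e0…, port = scratch but for this
  title and the r85-w1 wording; `--supports stmt-Schanuel-33364`, no credit):
  THEOREM C's binder WEAKENED — the boundary `deg_Y P = m₀ · xdeg P` of node 12's height grading needs only a
  ONE-SIDED ε-form of the height comparison whose additive constant grows at most like `exp (B/ε)`; the window theorem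
  (which growth the boundary arithmetic tolerates) kernel-checked; the member `W4` re-threaded (×0 re-grading; no
  decision; rung 0)

Parts 01–02 (census-1 g32, «HEIGHT-BOUNDARY») closed node 12's boundary case modulo Néron's TWO-SIDED `O(√h)` comparison
`SqrtComparisonAt P` / the print binder `HeightComparisonSqrt` (Bombieri–Gubler 2006 Cor. 9.3.10).  The question left on
the bus (HANDOFF-census gen 32 «Open»; crit L3510 obs-r1) was: WHICH error terms does THEOREM C's inequality actually
tolerate, and is the `√h`-binder needed at all?  THIS FILE answers by theorems, not prose:

* §6 the per-curve predicate `UpperComparisonExpAt P` («effective ε-form»): `∃ B, ∀ ε ∈ (0, 1], ∀ (x, y) ∈ (P = 0)(ℚ),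
  deg_Y P · h(y) ≤ (xdeg P + ε) · h(x) + exp (B/ε)` — ONE-SIDED (upper) and with an additive constant of growth
  `exp (O(1/ε))`.  It sits inside the tree's ladder of comparison shapes (by implication; no separation is claimed):
  `SqrtComparisonAt P → UpperComparisonExpAt P → UpperComparisonAt P` (`upperComparisonExpAt_of_sqrt`, AM–GM with
  `c²/(4ε) + |c| + 1 ≤ exp ((c²/4 + |c|)/ε)`; `upperComparisonAt_of_exp`, trivial), and it is EXACTLY the output shape of
  node 31's Siegel-function argument `RootDecomp1KSiegelFunctions.upperComparisonAt_of_siegelFunctions` once its constants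
  are tracked in the order `b ≈ 1/ε` of the Siegel functions (`upperComparisonExpAt_of_pow`: a comparison
  `n·h(y) ≤ (k + c₀/b)·h(x) + exp (B·b)` for every `b ≥ 1` gives `UpperComparisonExpAt P`).  NOT proved here for any
  curve of positive genus; used ONLY as an explicit hypothesis.  (What an unconditional proof needs is booked in the census:
  height control of the Riemann–Roch functions of node 31-G — Coates 1970 / Schmidt 1990 «Eisenstein's theorem», B–G §11.4 —
  a programme, not a node.)
* §7 THE WINDOW THEOREM (real arithmetic, no Diophantine input; `not_clause_of_exp_height`): at `deg_Y P = m₀·k` the upper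
  bound `m₀k·log d ≤ (k + ε)·(N!·log 2 + log 2) + exp (B/ε)` FOR ALL `ε ∈ (0, 1]` forces the FAILURE of the clause
  `C·2^{(N+1)!} < d^{m₀N}` for `N ≥ N₀(k, B, C)`: choose `ε = 1/(2N)`; the clause's surplus `k·(N−1)!·log 2` beats
  `(N−1)!·log 2/2 + exp (2BN) + O(1)` because `exp (2BN) = o((N−1)!)` (Mathlib `Real.pow_div_factorial_le_exp`).  So the
  boundary tolerates an additive constant `exp (O(1/ε))` — the critic's first alternative in obs-r1 — while a FIXED `ε`
  (node 12's `HeightComparison`, Lang's ε-form) is short by the factor `εN` (THEOREM B's docstring).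
* §8 THEOREM C″: for `P` with `xdeg P ≥ 1` on the boundary `deg_Y P = m₀ · xdeg P` (any `m₀`) satisfying
  `UpperComparisonExpAt P`: `ThinFibreAt m₀ P ↔ BddLevelEmpty P ↔ LevelFinite P` (`←` hypothesis-free as in the tree).
  Part 01's THEOREM C is the special case through `upperComparisonExpAt_of_sqrt`.
* §9 the member: `thinFibreAt_two_W4P_iff_levelFinite_of_exp (hW : UpperComparisonExpAt W4P) : ThinFibreAt 2 W4P ↔
  LevelFinite W4P`, and `upperComparisonExpAt_W4P_of_sqrt : HeightComparisonSqrt → UpperComparisonExpAt W4P`.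

HONEST SCOPE.  ×0 by class (a height-type re-grading, K-R42 (vii′)); NO decision: row 36 «W4» stays UNDECIDED OF RECORD
×1, payable only by a hypothesis-free `LevelFinite W4P` / `ThinFibreAt 2 W4P`; what the file adds to the record is that the
«one currency» reading of row 36 holds modulo a ONE-SIDED EFFECTIVE ε-FORM (weaker than Néron's theorem and of the shape the
tree's own node-31 route produces), and the exact growth the boundary tolerates.  Nothing here proves Schanuel,
`FiniteOrderLiouvilleSchanuel` (33364), 33363, 31077, 31987, `ThinFibre 2`, `ThinFibreAt 2 W4P` or `LevelFinite W4P`.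
Imports: part 02 only.  No Literature import, no sorry, no set_option, no private, no instance, no notation.
-/

noncomputable section

namespace Summit.Schanuel.Schanuel.Theorems.RootDecomp1KHeightBoundary

open Polynomial LiouvilleNumber
open scoped Nat Polynomial.Bivariate
open Summit.Schanuel.Schanuel.Theorems.RootDecomp1KDegreeLadder
open Summit.Schanuel.Schanuel.Theorems.RootDecomp1KLevelFinite (LevelFinite)
open Summit.Schanuel.Schanuel.Theorems.RootDecomp1KHeightGrading
open Summit.Schanuel.Schanuel.Theorems.RootDecomp1KSubspaceBranch (PadicSubspace)
open Summit.Schanuel.Schanuel.Theorems.RootDecomp1KOddEmpty (W4P)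
open Summit.Schanuel.Schanuel.Theorems.RootDecomp1KW4Dossier (natDegree_W4P xdeg_W4P thinFibreAt_W4P_of_padicSubspace)
open Summit.Schanuel.Schanuel.Theorems.RootDecomp1KSiegelFunctions (UpperComparisonAt)

/-! ### §6  The effective ε-form: a one-sided comparison with additive constant `exp (O(1/ε))` -/

/-- [auxiliary predicate] (definition with a parameter, not a fact): **the EFFECTIVE one-sided ε-form of the height
comparison holds on the curve `P = 0`** — there is a constant `B` with
`deg_Y P · h(y) ≤ (xdeg P + ε) · h(x) + exp (B/ε)` for every `ε ∈ (0, 1]` at every RATIONAL point `(x, y)` of `P = 0`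
(`h = logHt`).  Between Néron's `O(√h)` form (`SqrtComparisonAt P`, part 01; it implies this one,
`upperComparisonExpAt_of_sqrt`) and the tree's plain ε-form (`RootDecomp1KSiegelFunctions.UpperComparisonAt P`, which it
implies, `upperComparisonAt_of_exp`); the shape node 31's Siegel functions of order `b ≈ 1/ε` deliver once the heights of
the relation coefficients and of the exceptional points are bounded by `exp (O(b))` (`upperComparisonExpAt_of_pow`).  NOT
proved in the tree for any curve of positive genus; the theorems of §8–§9 take it curve by curve as an explicit hypothesis. -/
def UpperComparisonExpAt (P : ℤ[X][X]) : Prop :=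
  ∃ B : ℝ, ∀ ε : ℝ, 0 < ε → ε ≤ 1 → ∀ x y : ℚ, bev P x y = 0 →
    (P.natDegree : ℝ) * logHt y ≤ ((xdeg P : ℝ) + ε) * logHt x + Real.exp (B / ε)

/-- the effective ε-form implies the tree's one-sided ε-form `UpperComparisonAt P` (constant `exp (B / min ε 1)`). -/
theorem upperComparisonAt_of_exp {P : ℤ[X][X]} (h : UpperComparisonExpAt P) : UpperComparisonAt P := by
  intro ε hε
  obtain ⟨B, hB⟩ := h
  refine ⟨Real.exp (B / min ε 1), fun x y hxy => ?_⟩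
  have h1 := hB (min ε 1) (lt_min hε one_pos) (min_le_right _ _) x y hxy
  have h0 : 0 ≤ logHt x := logHt_nonneg x
  have h2 : ((xdeg P : ℝ) + min ε 1) * logHt x ≤ ((xdeg P : ℝ) + ε) * logHt x :=
    mul_le_mul_of_nonneg_right (by linarith [min_le_left ε 1]) h0
  linarith

/-- **Néron's form implies the effective ε-form**: `SqrtComparisonAt P → UpperComparisonExpAt P` with `B = c²/4 + |c|`
(AM–GM `|c|·√h ≤ ε·h + c²/(4ε)`, and `c²/(4ε) + |c| ≤ (c²/4 + |c|)/ε ≤ exp ((c²/4 + |c|)/ε)` for `ε ≤ 1`). -/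
theorem upperComparisonExpAt_of_sqrt {P : ℤ[X][X]} (h : SqrtComparisonAt P) : UpperComparisonExpAt P := by
  obtain ⟨c, hc⟩ := h
  refine ⟨c ^ 2 / 4 + |c|, fun ε hε hε1 x y hxy => ?_⟩
  have hb := hc x y hxy
  have h0 : 0 ≤ logHt x := logHt_nonneg x
  set t : ℝ := Real.sqrt (logHt x) with ht
  have ht0 : 0 ≤ t := Real.sqrt_nonneg _
  have ht2 : t ^ 2 = logHt x := Real.sq_sqrt h0
  -- one-sided: n·h(y) − k·h(x) ≤ |c|·t + |c|
  have e1 : (P.natDegree : ℝ) * logHt y - (xdeg P : ℝ) * logHt x ≤ |c| * t + |c| := by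
    have h1 := (neg_le_abs _).trans hb
    have h2 : c * t ≤ |c| * t := mul_le_mul_of_nonneg_right (le_abs_self c) ht0
    linarith [le_abs_self c]
  -- AM–GM: |c|·t ≤ ε·t² + c²/(4ε)
  have e2 : |c| * t ≤ ε * t ^ 2 + c ^ 2 / (4 * ε) := by
    have h4 : c ^ 2 / (4 * ε) * (4 * ε) = c ^ 2 := div_mul_cancel₀ _ (by positivity)
    nlinarith [sq_nonneg (2 * ε * t - |c|), h4, sq_abs c]
  -- the constant: c²/(4ε) + |c| ≤ (c²/4 + |c|)/ε ≤ exp ((c²/4 + |c|)/ε)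
  have e3 : c ^ 2 / (4 * ε) + |c| ≤ (c ^ 2 / 4 + |c|) / ε := by
    have h5 : (c ^ 2 / 4 + |c|) / ε = c ^ 2 / (4 * ε) + |c| / ε := by rw [add_div, div_div]
    have h6 : |c| ≤ |c| / ε := by rw [le_div_iff₀ hε]; nlinarith [abs_nonneg c]
    linarith
  have e4 : (c ^ 2 / 4 + |c|) / ε ≤ Real.exp ((c ^ 2 / 4 + |c|) / ε) := by
    linarith [Real.add_one_le_exp ((c ^ 2 / 4 + |c|) / ε)]
  rw [ht2] at e2
  linarith

/-- the effective ε-form from a comparison IN THE ORDER `b` of Siegel functions (the shape of node 31's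
`upperComparisonAt_of_siegelFunctions` with its constants tracked): if for every `b ≥ 1`
`deg_Y P · h(y) ≤ (xdeg P + c₀/b) · h(x) + exp (B·b)` at every rational point, then `UpperComparisonExpAt P`
(take `b = ⌈c₀/ε⌉ + 1 ≤ (|c₀| + 1)/ε + 1`, so `exp (B·b) ≤ exp ((|B|·(|c₀| + 2))/ε)` for `ε ≤ 1`). -/
theorem upperComparisonExpAt_of_pow {P : ℤ[X][X]} {c₀ B : ℝ}
    (h : ∀ b : ℕ, 1 ≤ b → ∀ x y : ℚ, bev P x y = 0 →
      (P.natDegree : ℝ) * logHt y ≤ ((xdeg P : ℝ) + c₀ / b) * logHt x + Real.exp (B * b)) :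
    UpperComparisonExpAt P := by
  refine ⟨|B| * (|c₀| + 2), fun ε hε hε1 x y hxy => ?_⟩
  set b : ℕ := ⌈c₀ / ε⌉₊ + 1 with hbdef
  have hb1 : 1 ≤ b := by omega
  have hbpos : (0 : ℝ) < b := by exact_mod_cast hb1
  have h1 := h b hb1 x y hxy
  have h0 : 0 ≤ logHt x := logHt_nonneg x
  -- c₀/b ≤ ε
  have hcb : c₀ / b ≤ ε := by
    rw [div_le_iff₀ hbpos]
    have h2 : c₀ / ε ≤ ⌈c₀ / ε⌉₊ := Nat.le_ceil _
    have h4 : (b : ℝ) = (⌈c₀ / ε⌉₊ : ℝ) + 1 := by rw [hbdef]; push_cast; ring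
    have h5 : ε * (c₀ / ε) = c₀ := mul_div_cancel₀ _ hε.ne'
    rw [h4]
    linarith [mul_le_mul_of_nonneg_left h2 hε.le]
  have e1 : ((xdeg P : ℝ) + c₀ / b) * logHt x ≤ ((xdeg P : ℝ) + ε) * logHt x :=
    mul_le_mul_of_nonneg_right (by linarith) h0
  -- b ≤ (|c₀| + 2)/ε, hence B·b ≤ |B|·(|c₀| + 2)/ε
  have hbup : (b : ℝ) ≤ (|c₀| + 2) / ε := by
    have h2 : ⌈c₀ / ε⌉₊ ≤ ⌈|c₀| / ε⌉₊ := Nat.ceil_mono (div_le_div_of_nonneg_right (le_abs_self c₀) hε.le)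
    have h3 : (⌈|c₀| / ε⌉₊ : ℝ) < |c₀| / ε + 1 := Nat.ceil_lt_add_one (by positivity)
    have h4 : (b : ℝ) = (⌈c₀ / ε⌉₊ : ℝ) + 1 := by rw [hbdef]; push_cast; ring
    have h5 : (⌈c₀ / ε⌉₊ : ℝ) ≤ (⌈|c₀| / ε⌉₊ : ℝ) := by exact_mod_cast h2
    have h6 : (2 : ℝ) ≤ 2 / ε := by rw [le_div_iff₀ hε]; linarith
    rw [h4, add_div]
    linarith
  have e2 : Real.exp (B * b) ≤ Real.exp (|B| * (|c₀| + 2) / ε) := by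
    refine Real.exp_le_exp.mpr ?_
    have h2 : B * b ≤ |B| * b := mul_le_mul_of_nonneg_right (le_abs_self B) hbpos.le
    have h3 : |B| * (b : ℝ) ≤ |B| * ((|c₀| + 2) / ε) := mul_le_mul_of_nonneg_left hbup (abs_nonneg B)
    rw [mul_div_assoc]
    linarith
  linarith

/-! ### §7  The window theorem: which additive constants the boundary arithmetic tolerates (real arithmetic) -/

/-- `exp (2BN) = o((N − 1)!)`, quantitatively: `exp (2B)^N ≤ exp (4·exp (2B)) · (N − 1)! / N` for `N ≥ 1`
(from Mathlib `Real.pow_div_factorial_le_exp`: `(4y)^N ≤ N!·exp (4y)`, and `N² ≤ 4^N`). -/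
theorem exp_pow_le_pred_factorial (B : ℝ) {N : ℕ} (hN : 1 ≤ N) :
    Real.exp (2 * B) ^ N ≤ Real.exp (4 * Real.exp (2 * B)) * ((N - 1)! : ℝ) / N := by
  set y : ℝ := Real.exp (2 * B) with hy
  have hy0 : 0 < y := Real.exp_pos _
  have h1 := Real.pow_div_factorial_le_exp (4 * y) (by positivity) N
  have hfac : (0 : ℝ) < N ! := by exact_mod_cast Nat.factorial_pos N
  rw [div_le_iff₀ hfac, mul_pow] at h1
  -- N! = N · (N-1)!
  have hNF : (N ! : ℝ) = N * ((N - 1)! : ℝ) := by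
    exact_mod_cast (Nat.mul_factorial_pred (by omega : N ≠ 0)).symm
  have hN0 : (0 : ℝ) < N := by exact_mod_cast hN
  -- N² ≤ 4^N
  have hsq : (N : ℝ) ^ 2 ≤ (4 : ℝ) ^ N := by
    have h2 : N < 2 ^ N := Nat.lt_two_pow_self
    have h3 : N ^ 2 ≤ (2 ^ N) ^ 2 := Nat.pow_le_pow_left h2.le 2
    have h4 : (2 ^ N) ^ 2 = 4 ^ N := by rw [← pow_mul, mul_comm, pow_mul]; norm_num
    rw [h4] at h3
    exact_mod_cast h3
  rw [hNF] at h1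
  rw [le_div_iff₀ hN0]
  -- y^N · N ≤ exp(4y)·(N-1)!  ⟸  4^N y^N ≤ exp(4y) N (N-1)!  and N² ≤ 4^N
  have hF0 : (0 : ℝ) ≤ ((N - 1)! : ℝ) := by positivity
  have hyN : 0 ≤ y ^ N := by positivity
  have h5 : y ^ N * N * N ≤ y ^ N * (4 : ℝ) ^ N := by nlinarith
  have h6 : (4 : ℝ) ^ N * y ^ N ≤ Real.exp (4 * y) * (N * ((N - 1)! : ℝ)) := h1
  have h7 : (y ^ N * N) * N ≤ (Real.exp (4 * y) * ((N - 1)! : ℝ)) * N := by nlinarith [Real.exp_pos (4 * y)]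
  exact le_of_mul_le_mul_right h7 hN0

/-- the linear step of the window theorem: the clause in logarithmic form `log C + (N+1)·(N·F)·L < m₀·N·log d` and the
upper bound `m₀k·log d ≤ k·(N·F·L + L) + err` give `k·F·L < k·L + err` (`F = (N−1)!`, `L = log 2`). -/
theorem key_of_clause {k m₀ N F L logC logd err : ℝ} (hk : 0 < k) (hN : 0 < N) (hlogC : 0 ≤ logC)
    (hcl : logC + (N + 1) * (N * F) * L < m₀ * N * logd) (hineq : m₀ * k * logd ≤ k * (N * F * L + L) + err) :
    k * F * L < k * L + err := by
  have h1 : k * ((N + 1) * (N * F) * L) < k * (m₀ * N * logd) := by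
    have := mul_lt_mul_of_pos_left (lt_of_le_of_lt (le_add_of_nonneg_left hlogC) hcl) hk
    linarith
  have h2 : N * (m₀ * k * logd) ≤ N * (k * (N * F * L + L) + err) := mul_le_mul_of_nonneg_left hineq hN.le
  have h3 : N * (k * F * L) < N * (k * L + err) := by nlinarith
  exact lt_of_mul_lt_mul_left h3 hN.le

/-- the closing step of the window theorem: `k ≥ 1`, `F ≥ 6`, `1/2 < L`, `k·F·L < k·L + err` and
`err ≤ F·L/2 + L/2 + F/8` are contradictory. -/
theorem window_contra {k F L err : ℝ} (hk : 1 ≤ k) (hF : 6 ≤ F) (hL : 1 / 2 < L)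
    (key : k * F * L < k * L + err) (herr : err ≤ F * L / 2 + L / 2 + F / 8) : False := by
  -- (F − 1)·L ≤ k·F·L − k·L
  have ha : (F - 1) * L ≤ k * F * L - k * L := by
    nlinarith [mul_nonneg (mul_nonneg (by linarith : (0:ℝ) ≤ k - 1) (by linarith : (0:ℝ) ≤ F - 1))
      (by linarith : (0:ℝ) ≤ L)]
  -- hence (F/2 − 3/2)·L < F/8; with L > 1/2 and F ≥ 6: F/4 − 3/4 < F/8, i.e. F < 6 — contradiction
  nlinarith [mul_pos (by linarith : (0:ℝ) < F / 2 - 3 / 2) (by linarith : (0:ℝ) < L - 1 / 2)]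

/-- **THE WINDOW THEOREM behind THEOREM C″** (the boundary `n = m₀·k`): the upper height bound
`m₀k·log d ≤ (k + ε)·(L + log 2) + exp (B/ε)` for ALL `ε ∈ (0, 1]` (`L = N!·log 2`; any real `B`, any `m₀`) forces the
FAILURE of the clause `C·2^{(N+1)!} < d^{m₀N}` for `N ≥ N₀(k, B, C)` (`C ≥ 1`): with `ε = 1/(2N)` the clause's surplus `k·(N−1)!·log 2`
beats `(N−1)!·log 2/2 + exp (2BN) + O(1)`.  An additive constant of growth `exp (O(1/ε))` is inside the tolerance. -/
theorem not_clause_of_exp_height {k : ℕ} (m₀ : ℕ) (hk : 1 ≤ k) (B : ℝ) {C : ℝ} (hC : 1 ≤ C) :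
    ∃ N₀ : ℕ, ∀ N : ℕ, N₀ ≤ N → ∀ d : ℕ, 1 ≤ d →
      (∀ ε : ℝ, 0 < ε → ε ≤ 1 →
        ((m₀ * k : ℕ) : ℝ) * Real.log (d : ℝ) ≤
          ((k : ℝ) + ε) * ((N ! : ℝ) * Real.log 2 + Real.log 2) + Real.exp (B / ε)) →
      ¬ (C * 2 ^ (N + 1)! < (d : ℝ) ^ (m₀ * N)) := by
  obtain ⟨M, hM⟩ := exists_nat_ge (8 * Real.exp (4 * Real.exp (2 * B)))
  refine ⟨max M 4, fun N hN d hd hineq hcl => ?_⟩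
  have hNM : M ≤ N := le_trans (le_max_left _ _) hN
  have hN4 : 4 ≤ N := le_trans (le_max_right _ _) hN
  obtain ⟨hl2, -⟩ := log_two_bounds
  have hNF : (N ! : ℝ) = N * ((N - 1)! : ℝ) := by
    exact_mod_cast (Nat.mul_factorial_pred (by omega : N ≠ 0)).symm
  have hF6 : (6 : ℝ) ≤ ((N - 1)! : ℝ) := by
    have h : (3 : ℕ)! ≤ (N - 1)! := Nat.factorial_le (by omega)
    exact_mod_cast h
  have hN1 : (1 : ℝ) ≤ N := by exact_mod_cast (show 1 ≤ N by omega)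
  have hN0 : (0 : ℝ) < N := by linarith
  have hNK : 8 * Real.exp (4 * Real.exp (2 * B)) ≤ N := hM.trans (by exact_mod_cast hNM)
  have hk0 : (0 : ℝ) < k := by exact_mod_cast hk
  have hC0 : 0 < C := by linarith
  have hd0 : (0 : ℝ) < d := by exact_mod_cast hd
  -- the hypothesis at ε = 1/(2N)
  have hε0 : (0 : ℝ) < 1 / (2 * N) := by positivity
  have hε1 : 1 / (2 * (N : ℝ)) ≤ 1 := by
    rw [div_le_iff₀ (by positivity)]; linarith
  have hyp := hineq (1 / (2 * N)) hε0 hε1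
  -- exp (B / (1/(2N))) = exp(2B)^N ≤ exp (4·exp (2B)) · (N-1)! / N ≤ (N-1)! / 8
  have hexp : Real.exp (B / (1 / (2 * (N : ℝ)))) = Real.exp (2 * B) ^ N := by
    rw [show B / (1 / (2 * (N : ℝ))) = (N : ℝ) * (2 * B) by rw [div_div_eq_mul_div, div_one]; ring]
    exact Real.exp_nat_mul _ _
  have hE : Real.exp (B / (1 / (2 * (N : ℝ)))) ≤ ((N - 1)! : ℝ) / 8 := by
    rw [hexp]
    refine (exp_pow_le_pred_factorial B (show 1 ≤ N by omega)).trans ?_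
    rw [div_le_div_iff₀ hN0 (by norm_num)]
    have hF0 : (0 : ℝ) ≤ ((N - 1)! : ℝ) := by positivity
    nlinarith
  -- the clause in logarithmic form: log C + (N+1)·N!·log 2 < m₀·N·log d
  have hcl' := hcl
  rw [← Real.log_lt_log_iff (by positivity) (by positivity), Real.log_mul hC0.ne' (by positivity), Real.log_pow,
    Real.log_pow] at hcl'
  push_cast at hcl'
  have hfact : (((N + 1)! : ℕ) : ℝ) = ((N : ℝ) + 1) * (N ! : ℝ) := by
    rw [Nat.factorial_succ]; push_cast; ring
  rw [hfact, hNF] at hcl'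
  -- the upper bound with `N! = N·(N-1)!` and the error term isolated
  have hineq' : (m₀ : ℝ) * k * Real.log d ≤
      (k : ℝ) * (N * ((N - 1)! : ℝ) * Real.log 2 + Real.log 2) +
        (1 / (2 * (N : ℝ)) * ((N : ℝ) * ((N - 1)! : ℝ) * Real.log 2 + Real.log 2) +
          Real.exp (B / (1 / (2 * (N : ℝ))))) := by
    have e : ((m₀ * k : ℕ) : ℝ) = (m₀ : ℝ) * k := by push_cast; ring
    rw [e, hNF] at hyp
    linarith
  have key := key_of_clause hk0 hN0 (Real.log_nonneg hC) hcl' hineq'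
  -- the error term is at most F·log 2/2 + log 2/2 + F/8
  have herr : 1 / (2 * (N : ℝ)) * ((N : ℝ) * ((N - 1)! : ℝ) * Real.log 2 + Real.log 2) +
      Real.exp (B / (1 / (2 * (N : ℝ)))) ≤
      ((N - 1)! : ℝ) * Real.log 2 / 2 + Real.log 2 / 2 + ((N - 1)! : ℝ) / 8 := by
    have h1 : 1 / (2 * (N : ℝ)) * ((N : ℝ) * ((N - 1)! : ℝ) * Real.log 2 + Real.log 2) =
        ((N - 1)! : ℝ) * Real.log 2 / 2 + Real.log 2 / (2 * N) := by
      field_simp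
    have h2 : Real.log 2 / (2 * (N : ℝ)) ≤ Real.log 2 / 2 := by
      rw [div_le_div_iff₀ (by positivity) (by norm_num)]
      nlinarith
    linarith
  exact window_contra (by exact_mod_cast hk) hF6 hl2 key herr

/-! ### §8  THEOREM C″: the boundary modulo the effective ε-form -/

/-- at `deg_Y P = m₀ · xdeg P` (`xdeg P ≥ 1`; `m₀ ≥ 1` is not needed by the arithmetic) the clause
`C·2^{(N+1)!} < den(r)^{m₀N}` FAILS at every rational point of every large bounded level (`C ≥ 1`), modulo
`UpperComparisonExpAt P`. -/
theorem not_clause_eventually_boundary_of_exp {P : ℤ[X][X]} (hP : UpperComparisonExpAt P)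
    (hk : 1 ≤ xdeg P) {m₀ : ℕ} (heq : P.natDegree = m₀ * xdeg P) {C : ℝ} (hC : 1 ≤ C) :
    ∃ N₀ : ℕ, ∀ N : ℕ, N₀ ≤ N → ∀ r : ℚ, |(r : ℝ)| ≤ C → bev P (partialSum 2 N) r = 0 →
      ¬ (C * 2 ^ (N + 1)! < (r.den : ℝ) ^ (m₀ * N)) := by
  obtain ⟨B, hB⟩ := hP
  obtain ⟨N₀, hN₀⟩ := not_clause_of_exp_height m₀ hk B hC
  refine ⟨max N₀ 2, fun N hN r _hrC hroot => ?_⟩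
  have hNN₀ : N₀ ≤ N := le_trans (le_max_left _ _) hN
  have hN2 : 2 ≤ N := le_trans (le_max_right _ _) hN
  have hx : bev P ((xQ N : ℚ) : ℝ) (r : ℝ) = 0 := by rw [xQ_cast]; exact hroot
  have hupp := logHt_xQ_le hN2
  have hrlow := log_den_le_logHt r
  refine hN₀ N hNN₀ r.den r.den_pos fun ε hε hε1 => ?_
  have hb := hB ε hε hε1 (xQ N) r hx
  have e3 : ((xdeg P : ℝ) + ε) * logHt (xQ N) ≤ ((xdeg P : ℝ) + ε) * ((N ! : ℝ) * Real.log 2 + Real.log 2) :=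
    mul_le_mul_of_nonneg_left hupp (by positivity)
  have e4 : (P.natDegree : ℝ) * Real.log (r.den : ℝ) ≤ (P.natDegree : ℝ) * logHt r :=
    mul_le_mul_of_nonneg_left hrlow (by positivity)
  have e5 : ((m₀ * xdeg P : ℕ) : ℝ) = (P.natDegree : ℝ) := by rw [heq]
  rw [e5]
  linarith

/-- `ThinFibreAt m₀ P → BddLevelEmpty P` AT THE BOUNDARY `deg_Y P = m₀ · xdeg P` (modulo `UpperComparisonExpAt P`):
the clause can only hold vacuously, so the bounded fibres are eventually EMPTY. -/
theorem bddLevelEmpty_of_thinFibreAt_boundary_of_exp {P : ℤ[X][X]} (hP : UpperComparisonExpAt P)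
    (hk : 1 ≤ xdeg P) {m₀ : ℕ} (heq : P.natDegree = m₀ * xdeg P) (hT : ThinFibreAt m₀ P) :
    BddLevelEmpty P := by
  intro C
  obtain ⟨N₁, hN₁⟩ := hT (max C 1)
  obtain ⟨N₂, hN₂⟩ := not_clause_eventually_boundary_of_exp hP hk heq (le_max_right C 1)
  refine ⟨max N₁ N₂, fun N hN r hrC hroot hnd => ?_⟩
  have hrC' : |(r : ℝ)| ≤ max C 1 := hrC.trans (le_max_left _ _)
  exact hN₂ N (le_trans (le_max_right _ _) hN) r hrC' hroot
    (hN₁ N (le_trans (le_max_left _ _) hN) r hrC' hroot hnd)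

/-- **THEOREM C″ (per curve)** — for `P` with `xdeg P ≥ 1` ON THE BOUNDARY `deg_Y P = m₀ · xdeg P` (any `m₀`;
at `m₀ = 0` both sides say the bounded fibres are eventually empty) satisfying the effective one-sided ε-form `UpperComparisonExpAt P`: `ThinFibreAt m₀ P ↔ BddLevelEmpty P` (`←` is the
hypothesis-free `thinFibreAt_of_bddLevelEmpty`).  Part 01's THEOREM C (`thinFibreAt_iff_bddLevelEmpty_boundary`, modulo
Néron's `SqrtComparisonAt P`) is the special case `upperComparisonExpAt_of_sqrt`. -/
theorem thinFibreAt_iff_bddLevelEmpty_boundary_of_exp {P : ℤ[X][X]} (hP : UpperComparisonExpAt P)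
    (hk : 1 ≤ xdeg P) {m₀ : ℕ} (heq : P.natDegree = m₀ * xdeg P) :
    ThinFibreAt m₀ P ↔ BddLevelEmpty P :=
  ⟨bddLevelEmpty_of_thinFibreAt_boundary_of_exp hP hk heq, fun h => thinFibreAt_of_bddLevelEmpty h m₀⟩

/-- THEOREM C″ in the tree's wording: `ThinFibreAt m₀ P ↔ LevelFinite P` on the boundary (same hypotheses). -/
theorem thinFibreAt_iff_levelFinite_boundary_of_exp {P : ℤ[X][X]} (hP : UpperComparisonExpAt P)
    (hk : 1 ≤ xdeg P) {m₀ : ℕ} (heq : P.natDegree = m₀ * xdeg P) :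
    ThinFibreAt m₀ P ↔ LevelFinite P :=
  (thinFibreAt_iff_bddLevelEmpty_boundary_of_exp hP hk heq).trans (bddLevelEmpty_iff_levelFinite P)

/-! ### §9  The member `W4` at `m₀ = 2` under the weakened hypothesis -/

/-- **THE MEMBER (per curve, weakened hypothesis)**: if the effective one-sided ε-form holds on `W4` then
`ThinFibreAt 2 W4P ↔ LevelFinite W4P` — the «one currency» reading of row 36 needs only `UpperComparisonExpAt W4P`
(Néron's theorem on `X : z² = Δ(Y)` is sufficient, `upperComparisonExpAt_W4P_of_sqrt`, not necessary in form). -/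
theorem thinFibreAt_two_W4P_iff_levelFinite_of_exp (hW : UpperComparisonExpAt W4P) :
    ThinFibreAt 2 W4P ↔ LevelFinite W4P :=
  thinFibreAt_iff_levelFinite_boundary_of_exp hW (by rw [xdeg_W4P]; norm_num) boundary_W4P

/-- `ThinFibreAt 2 W4P ↔ BddLevelEmpty W4P` (same, in node 12's wording). -/
theorem thinFibreAt_two_W4P_iff_bddLevelEmpty_of_exp (hW : UpperComparisonExpAt W4P) :
    ThinFibreAt 2 W4P ↔ BddLevelEmpty W4P :=
  thinFibreAt_iff_bddLevelEmpty_boundary_of_exp hW (by rw [xdeg_W4P]; norm_num) boundary_W4P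

/-- the binder of parts 01–02 gives the weakened hypothesis on `W4`: `HeightComparisonSqrt → UpperComparisonExpAt W4P`. -/
theorem upperComparisonExpAt_W4P_of_sqrt (hH : HeightComparisonSqrt) : UpperComparisonExpAt W4P :=
  upperComparisonExpAt_of_sqrt (sqrtComparisonAt_W4P hH)

/-- level finiteness for `W4` from node 11's binder and the weakened height hypothesis:
`PadicSubspace → UpperComparisonExpAt W4P → LevelFinite W4P` — neither hypothesis is proved in the tree; row 36 stays
UNDECIDED OF RECORD. -/
theorem levelFinite_W4P_of_padicSubspace_of_exp (hS : PadicSubspace) (hW : UpperComparisonExpAt W4P) :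
    LevelFinite W4P :=
  (thinFibreAt_two_W4P_iff_levelFinite_of_exp hW).mp (thinFibreAt_W4P_of_padicSubspace hS le_rfl)

/-! ### pins (checked `example`s, no declarations): part 01's THEOREM C and part 02's member factor through §6–§9 -/

/-- pin: Néron's per-curve form gives the tree's one-sided ε-form through the effective ε-form. -/
example {P : ℤ[X][X]} (hP : SqrtComparisonAt P) : UpperComparisonAt P :=
  upperComparisonAt_of_exp (upperComparisonExpAt_of_sqrt hP)

/-- pin: part 01's THEOREM C (modulo `SqrtComparisonAt P`) re-derived through THEOREM C″. -/
example {P : ℤ[X][X]} (hP : SqrtComparisonAt P) (hk : 1 ≤ xdeg P) {m₀ : ℕ} (heq : P.natDegree = m₀ * xdeg P) :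
    ThinFibreAt m₀ P ↔ BddLevelEmpty P :=
  thinFibreAt_iff_bddLevelEmpty_boundary_of_exp (upperComparisonExpAt_of_sqrt hP) hk heq

/-- pin: part 02's member theorem (modulo `HeightComparisonSqrt`) re-derived through the weakened hypothesis. -/
example (hH : HeightComparisonSqrt) : ThinFibreAt 2 W4P ↔ LevelFinite W4P :=
  thinFibreAt_two_W4P_iff_levelFinite_of_exp (upperComparisonExpAt_W4P_of_sqrt hH)

end Summit.Schanuel.Schanuel.Theorems.RootDecomp1KHeightBoundary

end
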